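import Mathlib.MeasureTheory.Function.LpSeminorm.CompareExp
import Mathlib.Analysis.Calculus.ContDiff.Bounds
import Literature.Analysis.FluidPDE.TsaiLocalPressure
import Literature.Analysis.FluidPDE.TsaiPressureBootstrap
import HarnessLib

/-!
# Pointwise control of the localised normalised pressure by local Sobolev norms

Analysis/FluidPDE proofs layer for the decomposition of the named fact
`Literature.Analysis.FluidPDE.tsai1998_lemma32` (Tsai 1998, **Lemma 3.2**). The last step of the
printed bootstrap (p. 38: "By bootstrapping again, we get `osc(P, B_{1/8}) = o(|y₀|⁴)`", via the
interior Stokes estimate at `r = 6` and Morrey's imbedding) is replaced here by a direct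
estimate of the localised normalised pressure `N = p̃[θ_{x₀,ρ}U]` (`TsaiLocalPressure`), whose
difference with `P` has controlled gradient: since `N = Q[v]` is the Newtonian potential of the
quadratic source `G[v] = ∂ᵢ∂ⱼ(vᵢvⱼ)`, `v = θU` (`PressureRepresentation`:
`Q[v] = −(Γ₀ * G[v]) − (D²Γ∞) * (v ⊗ v)`),

  `|N(x)| ≤ ‖Γ₀‖_{L^{12/5}} ‖G[v]‖_{L^{12/7}} + ‖D²Γ∞‖_∞ ∫ |v|²`

by Hölder (the near kernel `Γ₀ = θΓ`, `|Γ₀(z)| ≤ (4π|z|)⁻¹`, lies in `L^s` for every `s < 3`) and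
the trivial bound for the bounded far kernel, while pointwise
`|G[v]| ≤ 2T |D²v| |v| + (T + T²) |Dv|²`, `T = ‖tr‖` (`abs_pressureSource_le`), and
`|v| ≤ |U|`, `|Dv| ≤ |DU| + C|U|`, `|D²v| ≤ |D²U| + C(|DU| + |U|)` on the support
`B̄(x₀, 8ρ)` of `θ`. Consequently (`exists_poly_bound_sup_localPressure`), polynomial bounds for
`‖D²U‖_{L²}`, `‖DU‖_{L⁶}`, `‖U‖_{L^{12}}` on `B(x₀, 9ρ)` (the output of the bootstrap,
`TsaiPressureBootstrap`) give a polynomial bound for `sup_{B̄(x₀,ρ)} |N|`, uniformly in the centre.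

Everything is proved; no definitions, no named facts.

## References

* T.-P. Tsai, *On Leray's self-similar solutions of the Navier–Stokes equations satisfying local
  energy estimates*, Arch. Rational Mech. Anal. 143 (1998), §3.2 (pp. 38–39) [Tsai1998].
* D. Gilbarg, N. S. Trudinger, *Elliptic partial differential equations of second order* (2001),
  Lemma 4.1–4.2 (the Newtonian potential) [GilbargTrudinger2001].
-/

noncomputable section

open MeasureTheory Set Function Filter Topology InnerProductSpace Metric
open scoped RealInnerProductSpace Laplacian ContDiff ENNReal NNReal

namespace Literature.Analysis.FluidPDE

/-! ### The quadratic source, pointwise -/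

section Source

variable {E : Type*} [NormedAddCommGroup E] [InnerProductSpace ℝ E] [FiniteDimensional ℝ E]

/-- `|tr L| ≤ ‖tr‖ ‖L‖`. [folklore] -/
theorem abs_traceCLM_le (L : E →L[ℝ] E) : |traceCLM L| ≤ ‖(traceCLM : (E →L[ℝ] E) →L[ℝ] ℝ)‖ * ‖L‖ := by
  rw [← Real.norm_eq_abs]; exact (traceCLM : (E →L[ℝ] E) →L[ℝ] ℝ).le_opNorm L

/-- **Pointwise bound for the quadratic source** `G[v] = div((v·∇)v + (div v) v) = ∂ᵢ∂ⱼ(vᵢvⱼ)` of a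
`C²` field: `|G[v](x)| ≤ 2T ‖D²v(x)‖ ‖v(x)‖ + (T + T²) ‖Dv(x)‖²`, `T = ‖tr‖` (expand
`D((v·∇)v) = D²v(·, v) + Dv ∘ Dv`, `D((div v)v) = D(div v) ⊗ v + (div v) Dv`, and bound each
trace). [folklore] -/
theorem abs_pressureSource_le {v : E → E} (hv : ContDiff ℝ 2 v) (x : E) :
    |pressureSource v x| ≤
      2 * ‖(traceCLM : (E →L[ℝ] E) →L[ℝ] ℝ)‖ * ‖fderiv ℝ (fderiv ℝ v) x‖ * ‖v x‖ +
        (‖(traceCLM : (E →L[ℝ] E) →L[ℝ] ℝ)‖ + ‖(traceCLM : (E →L[ℝ] E) →L[ℝ] ℝ)‖ ^ 2) *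
          ‖fderiv ℝ v x‖ ^ 2 := by
  set T : ℝ := ‖(traceCLM : (E →L[ℝ] E) →L[ℝ] ℝ)‖ with hT
  have hT0 : 0 ≤ T := by rw [hT]; exact norm_nonneg (traceCLM : (E →L[ℝ] E) →L[ℝ] ℝ)
  have hv1 : Differentiable ℝ v := hv.differentiable (by simp)
  have hDv : DifferentiableAt ℝ (fderiv ℝ v) x :=
    ((hv.fderiv_right (m := 1) le_rfl).differentiable one_ne_zero) x
  have hdiv : DifferentiableAt ℝ (VectorCalculus.divergence v) x :=
    ((contDiff_divergence (n := 1) hv).differentiable one_ne_zero) x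
  have hY1 : DifferentiableAt ℝ (fun y => fderiv ℝ v y (v y)) x := hDv.clm_apply (hv1 x)
  have hY2 : DifferentiableAt ℝ (fun y => VectorCalculus.divergence v y • v y) x := hdiv.smul (hv1 x)
  -- expand
  have hexp : pressureSource v x =
      traceCLM ((fderiv ℝ v x).comp (fderiv ℝ v x)) + traceCLM ((fderiv ℝ (fderiv ℝ v) x).flip (v x))
      + (fderiv ℝ (VectorCalculus.divergence v) x (v x) +
          VectorCalculus.divergence v x * traceCLM (fderiv ℝ v x)) := by
    rw [pressureSource_def, divergence_eq_traceCLM]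
    have h1 : (fun y => convect v v y + VectorCalculus.divergence v y • v y) =
        fun y => fderiv ℝ v y (v y) + VectorCalculus.divergence v y • v y := rfl
    rw [h1, fderiv_fun_add hY1 hY2, map_add, fderiv_clm_apply hDv (hv1 x), map_add,
      fderiv_fun_smul hdiv (hv1 x), map_add, traceCLM_smulRight, map_smul, smul_eq_mul]
    ring
  -- bound the four traces
  have b1 : |traceCLM ((fderiv ℝ v x).comp (fderiv ℝ v x))| ≤ T * ‖fderiv ℝ v x‖ ^ 2 :=
    (abs_traceCLM_le _).trans (by
      rw [sq]; exact mul_le_mul_of_nonneg_left (ContinuousLinearMap.opNorm_comp_le _ _) hT0)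
  have b2 : |traceCLM ((fderiv ℝ (fderiv ℝ v) x).flip (v x))| ≤ T * (‖fderiv ℝ (fderiv ℝ v) x‖ * ‖v x‖) :=
    (abs_traceCLM_le _).trans (by
      refine mul_le_mul_of_nonneg_left ?_ hT0
      calc ‖(fderiv ℝ (fderiv ℝ v) x).flip (v x)‖ ≤ ‖(fderiv ℝ (fderiv ℝ v) x).flip‖ * ‖v x‖ :=
            ContinuousLinearMap.le_opNorm _ _
        _ = ‖fderiv ℝ (fderiv ℝ v) x‖ * ‖v x‖ := by rw [ContinuousLinearMap.opNorm_flip])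
  have b3 : |fderiv ℝ (VectorCalculus.divergence v) x (v x)| ≤ T * (‖fderiv ℝ (fderiv ℝ v) x‖ * ‖v x‖) := by
    rw [fderiv_divergence_apply hv]
    refine (abs_traceCLM_le _).trans (mul_le_mul_of_nonneg_left (ContinuousLinearMap.le_opNorm _ _) hT0)
  have b4 : |VectorCalculus.divergence v x * traceCLM (fderiv ℝ v x)| ≤ T ^ 2 * ‖fderiv ℝ v x‖ ^ 2 := by
    rw [divergence_eq_traceCLM, abs_mul]
    have h := abs_traceCLM_le (fderiv ℝ v x)
    calc |traceCLM (fderiv ℝ v x)| * |traceCLM (fderiv ℝ v x)| ≤ (T * ‖fderiv ℝ v x‖) * (T * ‖fderiv ℝ v x‖) :=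
          mul_le_mul h h (abs_nonneg _) (by positivity)
      _ = T ^ 2 * ‖fderiv ℝ v x‖ ^ 2 := by ring
  rw [hexp]
  set A := traceCLM ((fderiv ℝ v x).comp (fderiv ℝ v x)) with hA
  set B := traceCLM ((fderiv ℝ (fderiv ℝ v) x).flip (v x)) with hB
  set C := fderiv ℝ (VectorCalculus.divergence v) x (v x) with hC
  set D := VectorCalculus.divergence v x * traceCLM (fderiv ℝ v x) with hD
  have htri : |A + B + (C + D)| ≤ |A| + |B| + |C| + |D| := by
    have h1 := abs_add_le (A + B) (C + D)
    have h2 := abs_add_le A B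
    have h3 := abs_add_le C D
    linarith
  nlinarith [b1, b2, b3, b4, htri]

end Source

/-! ### Derivatives of the localised field `θ_{x₀,ρ} U` -/

section Localised

/-- **First and second derivatives of a truncation `χ(· − x₀) U`**: if `|χ| ≤ 1`, `‖Dχ‖ ≤ C₁`,
`‖D²χ‖ ≤ C₂`, then `‖D(χU)‖ ≤ ‖DU‖ + C₁‖U‖` and `‖D²(χU)‖ ≤ ‖D²U‖ + 2C₁‖DU‖ + C₂‖U‖`
(Leibniz: Mathlib's `norm_iteratedFDeriv_smul_le`). [folklore] -/
theorem norm_iteratedFDeriv_two_cutoff_sub_smul_le {U : (EuclideanSpace ℝ (Fin 3)) → (EuclideanSpace ℝ (Fin 3))} (hU : ContDiff ℝ 2 U) {χ : (EuclideanSpace ℝ (Fin 3)) → ℝ}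
    (hχ : ContDiff ℝ 2 χ) {C₁ C₂ : ℝ} (h0 : ∀ z, |χ z| ≤ 1) (h1 : ∀ z, ‖fderiv ℝ χ z‖ ≤ C₁)
    (h2 : ∀ z, ‖iteratedFDeriv ℝ 2 χ z‖ ≤ C₂) (x₀ x : (EuclideanSpace ℝ (Fin 3))) :
    ‖iteratedFDeriv ℝ 2 (fun y : (EuclideanSpace ℝ (Fin 3)) => χ (y - x₀) • U y) x‖ ≤
      ‖iteratedFDeriv ℝ 2 U x‖ + 2 * C₁ * ‖fderiv ℝ U x‖ + C₂ * ‖U x‖ := by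
  have hχ' : ContDiff ℝ 2 fun y : (EuclideanSpace ℝ (Fin 3)) => χ (y - x₀) := hχ.comp (contDiff_id.sub contDiff_const)
  have hC₁ : 0 ≤ C₁ := (norm_nonneg _).trans (h1 0)
  have h := norm_iteratedFDeriv_smul_le (𝕜 := ℝ) hχ' hU x (n := 2) le_rfl
  refine h.trans ?_
  rw [Finset.sum_range_succ, Finset.sum_range_succ, Finset.sum_range_one]
  simp only [Nat.choose_zero_right, Nat.cast_one, one_mul, Nat.sub_zero, Nat.choose_one_right,
    Nat.cast_ofNat, Nat.reduceSub, Nat.choose_self]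
  rw [norm_iteratedFDeriv_zero, iteratedFDeriv_comp_sub, iteratedFDeriv_comp_sub, norm_iteratedFDeriv_one,
    norm_iteratedFDeriv_one, norm_iteratedFDeriv_zero, Real.norm_eq_abs]
  have e0 : |χ (x - x₀)| * ‖iteratedFDeriv ℝ 2 U x‖ ≤ ‖iteratedFDeriv ℝ 2 U x‖ :=
    mul_le_of_le_one_left (norm_nonneg _) (h0 _)
  have e1 : (2 : ℝ) * ‖fderiv ℝ χ (x - x₀)‖ * ‖fderiv ℝ U x‖ ≤ 2 * C₁ * ‖fderiv ℝ U x‖ := by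
    gcongr; exact h1 _
  have e2 : ‖iteratedFDeriv ℝ 2 χ (x - x₀)‖ * ‖U x‖ ≤ C₂ * ‖U x‖ :=
    mul_le_mul_of_nonneg_right (h2 _) (norm_nonneg _)
  linarith

/-- Uniform bounds for the cutoff `χ = cutoff s` and its first two derivatives (`|χ| ≤ 1`,
`‖Dχ‖ ≤ C₁/s`, `‖D²χ‖ ≤ C₂/s²`). [folklore] -/
theorem exists_cutoff_deriv_bounds {s : ℝ} (hs : 0 < s) :
    ∃ C₁ C₂ : ℝ, 0 ≤ C₁ ∧ 0 ≤ C₂ ∧ (∀ z : (EuclideanSpace ℝ (Fin 3)), |cutoff s z| ≤ 1) ∧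
      (∀ z : (EuclideanSpace ℝ (Fin 3)), ‖fderiv ℝ (cutoff s) z‖ ≤ C₁) ∧ (∀ z : (EuclideanSpace ℝ (Fin 3)), ‖iteratedFDeriv ℝ 2 (cutoff s) z‖ ≤ C₂) := by
  obtain ⟨A₁, hA₁0, hA₁⟩ := exists_norm_fderiv_cutoff_le (E := (EuclideanSpace ℝ (Fin 3)))
  obtain ⟨A₂, hA₂0, hA₂⟩ := exists_norm_fderiv_fderiv_cutoff_le (E := (EuclideanSpace ℝ (Fin 3)))
  refine ⟨A₁ / s, A₂ / s ^ 2, by positivity, by positivity, abs_cutoff_le_one s, hA₁ s hs, fun z => ?_⟩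
  rw [← norm_iteratedFDeriv_fderiv (n := 1), norm_iteratedFDeriv_one]
  exact hA₂ s hs z

/-- **Pointwise majorant for the quadratic source of the localised field**: with `θ = cutoff (4ρ) (· − x₀)`
and `v = θU`, `U ∈ C²`, there is `K = K(ρ)` (independent of `U`, `x₀`) such that
`|G[v](x)| ≤ K (‖D²U(x)‖ ‖U(x)‖ + ‖DU(x)‖ ‖U(x)‖ + ‖U(x)‖ ‖U(x)‖ + ‖DU(x)‖ ‖DU(x)‖)` everywhere, and
`G[v] = 0` off `B̄(x₀, 8ρ)`. [folklore] -/
theorem exists_abs_pressureSource_locF_le {ρ : ℝ} (hρ : 0 < ρ) :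
    ∃ K : ℝ, 0 ≤ K ∧ ∀ {U : (EuclideanSpace ℝ (Fin 3)) → (EuclideanSpace ℝ (Fin 3))}, ContDiff ℝ ∞ U → ∀ (x₀ x : (EuclideanSpace ℝ (Fin 3))),
      |pressureSource (fun w : (EuclideanSpace ℝ (Fin 3)) => cutoff (4 * ρ) (w - x₀) • U w) x| ≤
        K * (‖iteratedFDeriv ℝ 2 U x‖ * ‖U x‖ + ‖fderiv ℝ U x‖ * ‖U x‖ + ‖U x‖ * ‖U x‖ +
          ‖fderiv ℝ U x‖ * ‖fderiv ℝ U x‖) ∧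
      (x ∉ closedBall x₀ (8 * ρ) → pressureSource (fun w : (EuclideanSpace ℝ (Fin 3)) => cutoff (4 * ρ) (w - x₀) • U w) x = 0) := by
  obtain ⟨C₁, C₂, hC₁, hC₂, h0, h1, h2⟩ := exists_cutoff_deriv_bounds (by positivity : 0 < 4 * ρ)
  set T : ℝ := ‖(traceCLM : ((EuclideanSpace ℝ (Fin 3)) →L[ℝ] (EuclideanSpace ℝ (Fin 3))) →L[ℝ] ℝ)‖ with hT
  have hT0 : 0 ≤ T := by rw [hT]; exact norm_nonneg (traceCLM : ((EuclideanSpace ℝ (Fin 3)) →L[ℝ] (EuclideanSpace ℝ (Fin 3))) →L[ℝ] ℝ)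
  -- `K` dominates all coefficients
  set K : ℝ := 2 * T * (1 + 2 * C₁ + C₂) + (T + T ^ 2) * (2 + 2 * C₁ ^ 2) with hK
  refine ⟨K, by positivity, fun {U} hU x₀ x => ⟨?_, fun hx => ?_⟩⟩
  · have hU2 : ContDiff ℝ 2 U := hU.of_le (by norm_cast)
    have hχ : ContDiff ℝ 2 (cutoff (4 * ρ) : (EuclideanSpace ℝ (Fin 3)) → ℝ) := contDiff_cutoff _
    have hv2 : ContDiff ℝ 2 (fun w : (EuclideanSpace ℝ (Fin 3)) => cutoff (4 * ρ) (w - x₀) • U w) :=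
      (hχ.comp (contDiff_id.sub contDiff_const)).smul hU2
    have hG := abs_pressureSource_le hv2 x
    rw [← hT] at hG
    -- derivative bounds for `v`
    have hv0 : ‖cutoff (4 * ρ) (x - x₀) • U x‖ ≤ ‖U x‖ := by
      rw [norm_smul, Real.norm_eq_abs]; exact mul_le_of_le_one_left (norm_nonneg _) (h0 _)
    have hv1 : ‖fderiv ℝ (fun w : (EuclideanSpace ℝ (Fin 3)) => cutoff (4 * ρ) (w - x₀) • U w) x‖ ≤ ‖fderiv ℝ U x‖ + C₁ * ‖U x‖ := by
      have h := norm_fderiv_cutoff_sub_smul_le (hU.of_le (by norm_cast)) (C := C₁ * (4 * ρ)) (s := 4 * ρ)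
        (fun z => by rw [mul_div_assoc, div_self (by positivity : (4 * ρ : ℝ) ≠ 0), mul_one]; exact h1 z) x₀ x
      rwa [mul_div_assoc, div_self (by positivity : (4 * ρ : ℝ) ≠ 0), mul_one] at h
    have hv2' : ‖fderiv ℝ (fderiv ℝ (fun w : (EuclideanSpace ℝ (Fin 3)) => cutoff (4 * ρ) (w - x₀) • U w)) x‖ ≤
        ‖iteratedFDeriv ℝ 2 U x‖ + 2 * C₁ * ‖fderiv ℝ U x‖ + C₂ * ‖U x‖ := by
      have h := norm_iteratedFDeriv_two_cutoff_sub_smul_le hU2 hχ h0 h1 h2 x₀ x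
      have e : ‖iteratedFDeriv ℝ 2 (fun y : (EuclideanSpace ℝ (Fin 3)) => cutoff (4 * ρ) (y - x₀) • U y) x‖ =
          ‖fderiv ℝ (fderiv ℝ (fun w : (EuclideanSpace ℝ (Fin 3)) => cutoff (4 * ρ) (w - x₀) • U w)) x‖ := by
        rw [← norm_iteratedFDeriv_fderiv (n := 1), norm_iteratedFDeriv_one]
      rwa [e] at h
    -- combine
    set a := ‖iteratedFDeriv ℝ 2 U x‖ with ha
    set b := ‖fderiv ℝ U x‖ with hb
    set c := ‖U x‖ with hc
    have ha0 : 0 ≤ a := norm_nonneg _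
    have hb0 : 0 ≤ b := norm_nonneg _
    have hc0 : 0 ≤ c := norm_nonneg _
    refine hG.trans ?_
    have e1 : ‖fderiv ℝ (fderiv ℝ (fun w : (EuclideanSpace ℝ (Fin 3)) => cutoff (4 * ρ) (w - x₀) • U w)) x‖ *
        ‖cutoff (4 * ρ) (x - x₀) • U x‖ ≤ (a + 2 * C₁ * b + C₂ * c) * c :=
      mul_le_mul hv2' hv0 (norm_nonneg _) (by positivity)
    have e2 : ‖fderiv ℝ (fun w : (EuclideanSpace ℝ (Fin 3)) => cutoff (4 * ρ) (w - x₀) • U w) x‖ ^ 2 ≤ (b + C₁ * c) ^ 2 :=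
      pow_le_pow_left₀ (norm_nonneg _) hv1 2
    have e3 : (b + C₁ * c) ^ 2 ≤ 2 * b * b + 2 * C₁ ^ 2 * (c * c) := by nlinarith [sq_nonneg (b - C₁ * c)]
    set S := a * c + b * c + c * c + b * b with hS
    have hac : 0 ≤ a * c := mul_nonneg ha0 hc0
    have hbc : 0 ≤ b * c := mul_nonneg hb0 hc0
    have hcc : 0 ≤ c * c := mul_nonneg hc0 hc0
    have hbb : 0 ≤ b * b := mul_nonneg hb0 hb0
    have i1 : (a + 2 * C₁ * b + C₂ * c) * c ≤ (1 + 2 * C₁ + C₂) * S := by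
      rw [hS]; nlinarith [mul_nonneg hC₁ hac, mul_nonneg hC₁ hcc, mul_nonneg hC₁ hbb, mul_nonneg hC₂ hac,
        mul_nonneg hC₂ hbc, mul_nonneg hC₂ hbb]
    have i2 : 2 * b * b + 2 * C₁ ^ 2 * (c * c) ≤ (2 + 2 * C₁ ^ 2) * S := by
      rw [hS]; nlinarith [mul_nonneg (sq_nonneg C₁) hac, mul_nonneg (sq_nonneg C₁) hbc,
        mul_nonneg (sq_nonneg C₁) hbb]
    have m1 : 2 * T * ‖fderiv ℝ (fderiv ℝ (fun w : (EuclideanSpace ℝ (Fin 3)) => cutoff (4 * ρ) (w - x₀) • U w)) x‖ *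
        ‖cutoff (4 * ρ) (x - x₀) • U x‖ ≤ 2 * T * ((1 + 2 * C₁ + C₂) * S) := by
      rw [mul_assoc (2 * T)]
      exact mul_le_mul_of_nonneg_left (e1.trans i1) (by positivity)
    have m2 : (T + T ^ 2) * ‖fderiv ℝ (fun w : (EuclideanSpace ℝ (Fin 3)) => cutoff (4 * ρ) (w - x₀) • U w) x‖ ^ 2 ≤
        (T + T ^ 2) * ((2 + 2 * C₁ ^ 2) * S) :=
      mul_le_mul_of_nonneg_left ((e2.trans e3).trans i2) (by positivity)
    have hKS : K * S = 2 * T * ((1 + 2 * C₁ + C₂) * S) + (T + T ^ 2) * ((2 + 2 * C₁ ^ 2) * S) := by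
      rw [hK]; ring
    rw [hKS]
    linarith [m1, m2]
  · -- off `B̄(x₀, 8ρ)` the localised field vanishes near `x`
    have hopen : (closedBall x₀ (8 * ρ))ᶜ ∈ 𝓝 x := isClosed_closedBall.isOpen_compl.mem_nhds hx
    have hgerm : (fun w : (EuclideanSpace ℝ (Fin 3)) => cutoff (4 * ρ) (w - x₀) • U w) =ᶠ[𝓝 x] fun _ => (0 : (EuclideanSpace ℝ (Fin 3))) := by
      filter_upwards [hopen] with y hy
      exact locF_eq_zero hρ fun h => hy (ball_subset_closedBall h)
    rw [pressureSource_congr_of_eventuallyEq hgerm, pressureSource_def]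
    simp [VectorCalculus.divergence, convect]

end Localised

/-! ### The `L^{12/7}` norm of the quadratic source -/

section SourceNorm

/-- Hölder triples `(2, 12, 12/7)` and `(24/7, 24/7, 12/7)`. [folklore] -/
theorem holderTriple_twelve_sevenths :
    ENNReal.HolderTriple 2 12 (ENNReal.ofReal (12 / 7)) ∧
      ENNReal.HolderTriple (ENNReal.ofReal (24 / 7)) (ENNReal.ofReal (24 / 7)) (ENNReal.ofReal (12 / 7)) := by
  constructor
  · have h : ENNReal.HolderTriple (ENNReal.ofReal 2) (ENNReal.ofReal 12) (ENNReal.ofReal (12 / 7)) :=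
      Real.HolderTriple.ennrealOfReal ⟨by norm_num, by norm_num, by norm_num⟩
    rwa [ENNReal.ofReal_ofNat, ENNReal.ofReal_ofNat] at h
  · exact Real.HolderTriple.ennrealOfReal ⟨by norm_num, by norm_num, by norm_num⟩

/-- A function supported in `B̄(x₀, 8ρ)` has the same `L^p` norm on `(EuclideanSpace ℝ (Fin 3))` and on `B(x₀, 9ρ)`. [folklore] -/
theorem eLpNorm_eq_eLpNorm_restrict_of_support {G : Type*} [NormedAddCommGroup G] {f : (EuclideanSpace ℝ (Fin 3)) → G}
    {x₀ : (EuclideanSpace ℝ (Fin 3))} {ρ : ℝ} (hρ : 0 < ρ) (hf : ∀ x ∉ closedBall x₀ (8 * ρ), f x = 0) (p : ℝ≥0∞) :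
    eLpNorm f p volume = eLpNorm f p (volume.restrict (ball x₀ (9 * ρ))) := by
  have e1 : eLpNorm f p volume = eLpNorm ((ball x₀ (9 * ρ)).indicator f) p volume := by
    refine eLpNorm_congr_ae (Eventually.of_forall fun y => ?_)
    by_cases hy : y ∈ ball x₀ (9 * ρ)
    · exact (indicator_of_mem hy _).symm
    · rw [indicator_of_notMem hy]
      exact hf y fun h => hy (closedBall_subset_ball (by linarith) h)
  rw [e1, eLpNorm_indicator_eq_eLpNorm_restrict measurableSet_ball]

/-- **Polynomial `L^{12/7}` bound for the quadratic source of the localised field.** If on `B(x₀, 9ρ)`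
the norms `‖D²U‖_{L²}`, `‖DU‖_{L⁶}`, `‖U‖_{L^{12}}`, `‖DU‖_{L²}`, `‖U‖_{L²}` are bounded by
`K (1+|x₀|)^m` for all centres, then `‖G[θ_{x₀,ρ}U]‖_{L^{12/7}((EuclideanSpace ℝ (Fin 3)))} ≤ K' (1+|x₀|)^{2m}` for all
centres (`|G[v]| ≲ |D²U||U| + |DU||U| + |U|² + |DU|²`, Hölder with `(2,12)`, `(24/7,24/7)`).
[cite: Tsai1998, §3.2 (pp. 38–39)] -/
theorem exists_poly_bound_pressureSource_locF {U : (EuclideanSpace ℝ (Fin 3)) → (EuclideanSpace ℝ (Fin 3))} (hU : ContDiff ℝ ∞ U) {ρ : ℝ} (hρ : 0 < ρ)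
    {K : ℝ} (hK : 0 ≤ K) {m : ℕ}
    (hD2 : ∀ x₀ : (EuclideanSpace ℝ (Fin 3)), eLpNorm (fun x => iteratedFDeriv ℝ 2 U x) 2 (volume.restrict (ball x₀ (9 * ρ))) ≤
      ENNReal.ofReal (K * (1 + ‖x₀‖) ^ m))
    (hD6 : ∀ x₀ : (EuclideanSpace ℝ (Fin 3)), eLpNorm (fun x => fderiv ℝ U x) 6 (volume.restrict (ball x₀ (9 * ρ))) ≤
      ENNReal.ofReal (K * (1 + ‖x₀‖) ^ m))
    (hU12 : ∀ x₀ : (EuclideanSpace ℝ (Fin 3)), eLpNorm U 12 (volume.restrict (ball x₀ (9 * ρ))) ≤ ENNReal.ofReal (K * (1 + ‖x₀‖) ^ m))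
    (hD2' : ∀ x₀ : (EuclideanSpace ℝ (Fin 3)), eLpNorm (fun x => fderiv ℝ U x) 2 (volume.restrict (ball x₀ (9 * ρ))) ≤
      ENNReal.ofReal (K * (1 + ‖x₀‖) ^ m))
    (hU2 : ∀ x₀ : (EuclideanSpace ℝ (Fin 3)), eLpNorm U 2 (volume.restrict (ball x₀ (9 * ρ))) ≤ ENNReal.ofReal (K * (1 + ‖x₀‖) ^ m)) :
    ∃ K' : ℝ, 0 ≤ K' ∧ ∀ x₀ : (EuclideanSpace ℝ (Fin 3)),
      eLpNorm (pressureSource (fun w : (EuclideanSpace ℝ (Fin 3)) => cutoff (4 * ρ) (w - x₀) • U w)) (ENNReal.ofReal (12 / 7)) volume ≤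
        ENNReal.ofReal (K' * (1 + ‖x₀‖) ^ (m + m)) := by
  obtain ⟨KG, hKG, hG⟩ := exists_abs_pressureSource_locF_le hρ
  obtain ⟨hT1, hT2⟩ := holderTriple_twelve_sevenths
  haveI := hT1
  haveI := hT2
  have hUc : Continuous U := hU.continuous
  have hU1 : ContDiff ℝ 1 U := hU.of_le (by norm_cast)
  have hDUc : Continuous fun x => fderiv ℝ U x := hU1.continuous_fderiv one_ne_zero
  have hD2c : Continuous fun x => iteratedFDeriv ℝ 2 U x := hU.continuous_iteratedFDeriv (by norm_cast)
  -- the volume factor for `24/7 ≤ 6`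
  have h247_6 : ENNReal.ofReal (24 / 7) ≤ (6 : ℝ≥0∞) := by
    rw [← ENNReal.ofReal_ofNat]; exact ENNReal.ofReal_le_ofReal (by norm_num)
  have h247_1 : (1 : ℝ≥0∞) ≤ ENNReal.ofReal (24 / 7) := by
    rw [← ENNReal.ofReal_one]; exact ENNReal.ofReal_le_ofReal (by norm_num)
  set V : ℝ≥0∞ := (volume (ball (0 : (EuclideanSpace ℝ (Fin 3))) (9 * ρ))) ^ (1 / (ENNReal.ofReal (24 / 7)).toReal - 1 / (6 : ℝ≥0∞).toReal)
    with hV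
  have hVlt : V < ⊤ := volume_ball_rpow_lt_top _ (one_div_toReal_sub_nonneg h247_1 h247_6)
  have h127 : (1 : ℝ≥0∞) ≤ ENNReal.ofReal (12 / 7) := by
    rw [← ENNReal.ofReal_one]; exact ENNReal.ofReal_le_ofReal (by norm_num)
  refine ⟨KG * (3 * K * K + V.toReal ^ 2 * K * K), by positivity, fun x₀ => ?_⟩
  have ht : 0 ≤ ‖x₀‖ := norm_nonneg _
  set μ := (volume : Measure (EuclideanSpace ℝ (Fin 3))).restrict (ball x₀ (9 * ρ)) with hμ
  set Gv := pressureSource (fun w : (EuclideanSpace ℝ (Fin 3)) => cutoff (4 * ρ) (w - x₀) • U w) with hGv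
  -- reduce to the ball
  rw [eLpNorm_eq_eLpNorm_restrict_of_support hρ (fun x hx => (hG hU x₀ x).2 hx), ← hμ]
  -- pointwise majorant
  set A : (EuclideanSpace ℝ (Fin 3)) → ℝ := fun x => ‖iteratedFDeriv ℝ 2 U x‖ * ‖U x‖ with hA
  set B : (EuclideanSpace ℝ (Fin 3)) → ℝ := fun x => ‖fderiv ℝ U x‖ * ‖U x‖ with hB
  set C : (EuclideanSpace ℝ (Fin 3)) → ℝ := fun x => ‖U x‖ * ‖U x‖ with hC
  set D : (EuclideanSpace ℝ (Fin 3)) → ℝ := fun x => ‖fderiv ℝ U x‖ * ‖fderiv ℝ U x‖ with hD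
  have hmA : AEStronglyMeasurable A μ := (hD2c.norm.mul hUc.norm).aestronglyMeasurable
  have hmB : AEStronglyMeasurable B μ := (hDUc.norm.mul hUc.norm).aestronglyMeasurable
  have hmC : AEStronglyMeasurable C μ := (hUc.norm.mul hUc.norm).aestronglyMeasurable
  have hmD : AEStronglyMeasurable D μ := (hDUc.norm.mul hDUc.norm).aestronglyMeasurable
  have hpt : ∀ x, ‖Gv x‖ ≤ KG * ((A x + B x) + (C x + D x)) := fun x => by
    rw [Real.norm_eq_abs]
    have := (hG hU x₀ x).1
    simp only [hA, hB, hC, hD]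
    linarith
  have step1 : eLpNorm Gv (ENNReal.ofReal (12 / 7)) μ ≤
      ENNReal.ofReal KG * (eLpNorm A (ENNReal.ofReal (12 / 7)) μ + eLpNorm B (ENNReal.ofReal (12 / 7)) μ +
        (eLpNorm C (ENNReal.ofReal (12 / 7)) μ + eLpNorm D (ENNReal.ofReal (12 / 7)) μ)) := by
    calc eLpNorm Gv (ENNReal.ofReal (12 / 7)) μ
        ≤ eLpNorm (fun x => KG * ((A x + B x) + (C x + D x))) (ENNReal.ofReal (12 / 7)) μ := eLpNorm_mono_real hpt
      _ = ENNReal.ofReal KG * eLpNorm (fun x => (A x + B x) + (C x + D x)) (ENNReal.ofReal (12 / 7)) μ := by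
          have : (fun x => KG * ((A x + B x) + (C x + D x))) = KG • fun x => (A x + B x) + (C x + D x) := rfl
          rw [this, eLpNorm_const_smul, Real.enorm_eq_ofReal hKG]
      _ ≤ ENNReal.ofReal KG * (eLpNorm (fun x => A x + B x) (ENNReal.ofReal (12 / 7)) μ +
            eLpNorm (fun x => C x + D x) (ENNReal.ofReal (12 / 7)) μ) := by
          gcongr; exact eLpNorm_add_le (hmA.add hmB) (hmC.add hmD) h127
      _ ≤ _ := by
          gcongr
          · exact eLpNorm_add_le hmA hmB h127
          · exact eLpNorm_add_le hmC hmD h127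
  -- the four products
  have pA : eLpNorm A (ENNReal.ofReal (12 / 7)) μ ≤ ENNReal.ofReal ((K * K) * (1 + ‖x₀‖) ^ (m + m)) :=
    (eLpNorm_norm_mul_norm_le_measure hD2c.aestronglyMeasurable hUc.aestronglyMeasurable (q₁ := 2) (q₂ := 12)).trans
      ((mul_le_mul' (hD2 x₀) (hU12 x₀)).trans (le_of_eq (ofReal_poly_mul hK ht m m)))
  have pB : eLpNorm B (ENNReal.ofReal (12 / 7)) μ ≤ ENNReal.ofReal ((K * K) * (1 + ‖x₀‖) ^ (m + m)) :=
    (eLpNorm_norm_mul_norm_le_measure hDUc.aestronglyMeasurable hUc.aestronglyMeasurable (q₁ := 2) (q₂ := 12)).trans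
      ((mul_le_mul' (hD2' x₀) (hU12 x₀)).trans (le_of_eq (ofReal_poly_mul hK ht m m)))
  have pC : eLpNorm C (ENNReal.ofReal (12 / 7)) μ ≤ ENNReal.ofReal ((K * K) * (1 + ‖x₀‖) ^ (m + m)) :=
    (eLpNorm_norm_mul_norm_le_measure hUc.aestronglyMeasurable hUc.aestronglyMeasurable (q₁ := 2) (q₂ := 12)).trans
      ((mul_le_mul' (hU2 x₀) (hU12 x₀)).trans (le_of_eq (ofReal_poly_mul hK ht m m)))
  have hD247 : eLpNorm (fun x => fderiv ℝ U x) (ENNReal.ofReal (24 / 7)) μ ≤ ENNReal.ofReal ((V.toReal * K) * (1 + ‖x₀‖) ^ m) := by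
    calc eLpNorm (fun x => fderiv ℝ U x) (ENNReal.ofReal (24 / 7)) μ
        ≤ eLpNorm (fun x => fderiv ℝ U x) 6 μ * V := eLpNorm_ball_le_mul_eLpNorm hDUc.aestronglyMeasurable h247_6 x₀ _
      _ ≤ ENNReal.ofReal (K * (1 + ‖x₀‖) ^ m) * V := by gcongr; exact hD6 x₀
      _ = ENNReal.ofReal ((V.toReal * K) * (1 + ‖x₀‖) ^ m) := by rw [mul_comm, const_mul_ofReal_poly hVlt.ne]
  have pD : eLpNorm D (ENNReal.ofReal (12 / 7)) μ ≤ ENNReal.ofReal (((V.toReal * K) * (V.toReal * K)) * (1 + ‖x₀‖) ^ (m + m)) :=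
    (eLpNorm_norm_mul_norm_le_measure hDUc.aestronglyMeasurable hDUc.aestronglyMeasurable
      (q₁ := ENNReal.ofReal (24 / 7)) (q₂ := ENNReal.ofReal (24 / 7))).trans
      ((mul_le_mul' hD247 hD247).trans (le_of_eq (ofReal_poly_mul (by positivity) ht m m)))
  refine step1.trans ?_
  calc ENNReal.ofReal KG * (eLpNorm A (ENNReal.ofReal (12 / 7)) μ + eLpNorm B (ENNReal.ofReal (12 / 7)) μ +
        (eLpNorm C (ENNReal.ofReal (12 / 7)) μ + eLpNorm D (ENNReal.ofReal (12 / 7)) μ))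
      ≤ ENNReal.ofReal KG * (ENNReal.ofReal ((K * K) * (1 + ‖x₀‖) ^ (m + m)) +
          ENNReal.ofReal ((K * K) * (1 + ‖x₀‖) ^ (m + m)) +
          (ENNReal.ofReal ((K * K) * (1 + ‖x₀‖) ^ (m + m)) +
            ENNReal.ofReal (((V.toReal * K) * (V.toReal * K)) * (1 + ‖x₀‖) ^ (m + m)))) := by gcongr
    _ = ENNReal.ofReal ((KG * (3 * K * K + V.toReal ^ 2 * K * K)) * (1 + ‖x₀‖) ^ (m + m)) := by
        rw [← ENNReal.ofReal_add (by positivity) (by positivity), ← ENNReal.ofReal_add (by positivity) (by positivity),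
          ← ENNReal.ofReal_add (by positivity) (by positivity), ← ENNReal.ofReal_mul hKG]
        ring_nf

end SourceNorm

/-! ### The near kernel in `L^{12/5}` and the sup bound -/

section SupBound

-- nested operator types `(EuclideanSpace ℝ (Fin 3)) →L[ℝ] (EuclideanSpace ℝ (Fin 3)) →L[ℝ] (EuclideanSpace ℝ (Fin 3)) →L[ℝ] ℝ`
set_option maxSynthPendingDepth 3

/-- **The near kernel `Γ₀ = θΓ` lies in `L^{12/5}((EuclideanSpace ℝ (Fin 3)))`** (`|Γ₀(z)| ≤ (4π|z|)⁻¹` with support in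
`|z| ≤ 2`, and `|z|^{-12/5}` is integrable near the origin of `(EuclideanSpace ℝ (Fin 3))`). [folklore] -/
theorem memLp_newtonNear : MemLp (newtonNear (1 : ℝ) 2) (ENNReal.ofReal (12 / 5)) volume := by
  have hmeas : AEStronglyMeasurable (newtonNear (1 : ℝ) 2) volume :=
    (measurable_newtonNear 1 2).aestronglyMeasurable
  rw [← integrable_norm_rpow_iff hmeas (by norm_num) ENNReal.ofReal_ne_top,
    ENNReal.toReal_ofReal (by norm_num)]
  have hsupp : support (fun z : (EuclideanSpace ℝ (Fin 3)) => ‖newtonNear (1 : ℝ) 2 z‖ ^ (12 / 5 : ℝ)) ⊆ ball (0 : (EuclideanSpace ℝ (Fin 3))) 3 := by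
    intro z hz
    rw [mem_ball_zero_iff]
    by_contra h
    refine hz ?_
    show ‖newtonNear (1 : ℝ) 2 z‖ ^ (12 / 5 : ℝ) = 0
    rw [newtonNear_eq_zero zero_le_one one_lt_two (by linarith [not_lt.1 h]), norm_zero,
      Real.zero_rpow (by norm_num)]
  rw [← integrableOn_iff_integrable_of_support_subset hsupp]
  refine integrableOn_ball_of_norm_le_rpow (by rw [finrank_euclideanSpace_fin]; norm_num)
    (C := ((4 * Real.pi)⁻¹) ^ (12 / 5 : ℝ)) (α := 12 / 5) (by rw [finrank_euclideanSpace_fin]; norm_num)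
    (Eventually.of_forall fun z => ?_) ((hmeas.norm.aemeasurable.pow_const _).aestronglyMeasurable)
  rw [Real.norm_eq_abs, abs_of_nonneg (by positivity), Real.norm_eq_abs]
  have h := abs_newtonNear_le (1 : ℝ) 2 z
  calc |newtonNear 1 2 z| ^ (12 / 5 : ℝ) ≤ ((4 * Real.pi * ‖z‖)⁻¹) ^ (12 / 5 : ℝ) :=
        Real.rpow_le_rpow (abs_nonneg _) h (by norm_num)
    _ = ((4 * Real.pi)⁻¹) ^ (12 / 5 : ℝ) * ‖z‖ ^ (-(12 / 5) : ℝ) := by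
        rw [mul_inv, Real.mul_rpow (by positivity) (by positivity), Real.rpow_neg (norm_nonneg _),
          Real.inv_rpow (norm_nonneg _)]

/-- `∫ |v|² ≤ (‖U‖_{L²(B(x₀,9ρ))})²` for the localised field `v = θ_{x₀,ρ} U`. [folklore] -/
theorem integral_norm_locF_sq_le {U : (EuclideanSpace ℝ (Fin 3)) → (EuclideanSpace ℝ (Fin 3))} (hU : ContDiff ℝ ∞ U) {ρ : ℝ} (hρ : 0 < ρ) (x₀ : (EuclideanSpace ℝ (Fin 3))) :
    ∫ y, ‖(fun w : (EuclideanSpace ℝ (Fin 3)) => cutoff (4 * ρ) (w - x₀) • U w) y‖ ^ 2 ≤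
      (eLpNorm U 2 (volume.restrict (ball x₀ (9 * ρ)))).toReal ^ 2 := by
  set μ := (volume : Measure (EuclideanSpace ℝ (Fin 3))).restrict (ball x₀ (9 * ρ)) with hμ
  have hUc : Continuous U := hU.continuous
  have hmem : MemLp U 2 μ := memLp_restrict_ball_of_continuous hUc x₀ (9 * ρ) 2
  have hint : Integrable (fun y => ‖U y‖ ^ 2) μ := (memLp_two_iff_integrable_sq_norm hmem.1).1 hmem
  have h1 : ∫ y, ‖(fun w : (EuclideanSpace ℝ (Fin 3)) => cutoff (4 * ρ) (w - x₀) • U w) y‖ ^ 2 =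
      ∫ y, (ball x₀ (9 * ρ)).indicator (fun y => ‖(fun w : (EuclideanSpace ℝ (Fin 3)) => cutoff (4 * ρ) (w - x₀) • U w) y‖ ^ 2) y := by
    refine integral_congr_ae (Eventually.of_forall fun y => ?_)
    by_cases hy : y ∈ ball x₀ (9 * ρ)
    · exact (indicator_of_mem hy (fun y => ‖(fun w : (EuclideanSpace ℝ (Fin 3)) => cutoff (4 * ρ) (w - x₀) • U w) y‖ ^ 2)).symm
    · rw [indicator_of_notMem hy]
      have h0 : cutoff (4 * ρ) (y - x₀) • U y = 0 :=
        locF_eq_zero hρ fun h => hy (ball_subset_ball (by linarith) h)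
      show ‖cutoff (4 * ρ) (y - x₀) • U y‖ ^ 2 = 0
      rw [h0, norm_zero, zero_pow two_ne_zero]
  rw [h1, integral_indicator measurableSet_ball, ← hμ]
  have h2 : ∫ y, ‖(fun w : (EuclideanSpace ℝ (Fin 3)) => cutoff (4 * ρ) (w - x₀) • U w) y‖ ^ 2 ∂μ ≤ ∫ y, ‖U y‖ ^ 2 ∂μ := by
    refine integral_mono_of_nonneg (Eventually.of_forall fun y => by positivity) hint
      (Eventually.of_forall fun y => ?_)
    exact pow_le_pow_left₀ (norm_nonneg _) (norm_locF_le y) 2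
  refine h2.trans (le_of_eq ?_)
  rw [hmem.eLpNorm_eq_integral_rpow_norm two_ne_zero ENNReal.ofNat_ne_top, ENNReal.toReal_ofReal (by positivity),
    ENNReal.toReal_ofNat, ← Real.rpow_natCast, ← Real.rpow_mul (integral_nonneg fun y => by positivity)]
  norm_num

/-- **Polynomial sup bound for the localised normalised pressure.** If on `B(x₀, 9ρ)` the norms
`‖D²U‖_{L²}`, `‖DU‖_{L⁶}`, `‖U‖_{L^{12}}`, `‖DU‖_{L²}`, `‖U‖_{L²}` are bounded by `K (1+|x₀|)^m`
for all centres, then `|p̃[θ_{x₀,ρ}U](x)| ≤ K' (1+|x₀|)^{2m}` for all `x` and all centres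
(`p̃ = Q[v] = −Γ₀ * G[v] − (D²Γ∞) * (v ⊗ v)`, Hölder `‖Γ₀‖_{12/5} ‖G[v]‖_{12/7}` for the near part
and `‖D²Γ∞‖_∞ ∫|v|²` for the far part). [cite: Tsai1998, §3.2 (pp. 38–39)] -/
theorem exists_poly_bound_sup_localPressure {U : (EuclideanSpace ℝ (Fin 3)) → (EuclideanSpace ℝ (Fin 3))} (hU : ContDiff ℝ ∞ U) {ρ : ℝ} (hρ : 0 < ρ)
    {K : ℝ} (hK : 0 ≤ K) {m : ℕ}
    (hD2 : ∀ x₀ : (EuclideanSpace ℝ (Fin 3)), eLpNorm (fun x => iteratedFDeriv ℝ 2 U x) 2 (volume.restrict (ball x₀ (9 * ρ))) ≤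
      ENNReal.ofReal (K * (1 + ‖x₀‖) ^ m))
    (hD6 : ∀ x₀ : (EuclideanSpace ℝ (Fin 3)), eLpNorm (fun x => fderiv ℝ U x) 6 (volume.restrict (ball x₀ (9 * ρ))) ≤
      ENNReal.ofReal (K * (1 + ‖x₀‖) ^ m))
    (hU12 : ∀ x₀ : (EuclideanSpace ℝ (Fin 3)), eLpNorm U 12 (volume.restrict (ball x₀ (9 * ρ))) ≤ ENNReal.ofReal (K * (1 + ‖x₀‖) ^ m))
    (hD2' : ∀ x₀ : (EuclideanSpace ℝ (Fin 3)), eLpNorm (fun x => fderiv ℝ U x) 2 (volume.restrict (ball x₀ (9 * ρ))) ≤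
      ENNReal.ofReal (K * (1 + ‖x₀‖) ^ m))
    (hU2 : ∀ x₀ : (EuclideanSpace ℝ (Fin 3)), eLpNorm U 2 (volume.restrict (ball x₀ (9 * ρ))) ≤ ENNReal.ofReal (K * (1 + ‖x₀‖) ^ m)) :
    ∃ K' : ℝ, 0 ≤ K' ∧ ∀ x₀ x : (EuclideanSpace ℝ (Fin 3)),
      |normalisedPressure (fun w : (EuclideanSpace ℝ (Fin 3)) => cutoff (4 * ρ) (w - x₀) • U w) x| ≤ K' * (1 + ‖x₀‖) ^ (m + m) := by
  obtain ⟨KG, hKG, hG⟩ := exists_poly_bound_pressureSource_locF hU hρ hK hD2 hD6 hU12 hD2' hU2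
  obtain ⟨M₀, -, -, hM₀, -, -⟩ := exists_bounds_fderiv2_newtonFar (r₀ := (1 : ℝ)) (r₁ := 2) one_pos one_lt_two
  have hM₀0 : 0 ≤ M₀ := (norm_nonneg _).trans (hM₀ 0)
  set NΓ : ℝ := (eLpNorm (newtonNear (1 : ℝ) 2) (ENNReal.ofReal (12 / 5)) volume).toReal with hNΓ
  have hNΓ0 : 0 ≤ NΓ := ENNReal.toReal_nonneg
  refine ⟨NΓ * KG + M₀ * K ^ 2, by positivity, fun x₀ x => ?_⟩
  have ht : 0 ≤ ‖x₀‖ := norm_nonneg _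
  set v : (EuclideanSpace ℝ (Fin 3)) → (EuclideanSpace ℝ (Fin 3)) := fun w => cutoff (4 * ρ) (w - x₀) • U w with hv
  have hvs : ContDiff ℝ ∞ v := contDiff_locF hU
  have hvc : HasCompactSupport v := hasCompactSupport_locF hρ
  have hL2 : Integrable fun y => ‖v y‖ ^ 2 := integrable_norm_locF_sq hU hρ
  rw [normalisedPressure_locF_eq hU hρ, pressurePotential]
  -- far part
  have hfar : |farPotential 1 2 v x| ≤ M₀ * K ^ 2 * (1 + ‖x₀‖) ^ (m + m) := by
    refine (abs_farPotential_le hL2 hM₀ x).trans ?_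
    rw [mul_assoc]
    refine mul_le_mul_of_nonneg_left ?_ hM₀0
    have h1 := integral_norm_locF_sq_le hU hρ x₀
    have h2 : (eLpNorm U 2 (volume.restrict (ball x₀ (9 * ρ)))).toReal ≤ K * (1 + ‖x₀‖) ^ m :=
      ENNReal.toReal_le_of_le_ofReal (by positivity) (hU2 x₀)
    calc ∫ y, ‖v y‖ ^ 2 ≤ (eLpNorm U 2 (volume.restrict (ball x₀ (9 * ρ)))).toReal ^ 2 := h1
      _ ≤ (K * (1 + ‖x₀‖) ^ m) ^ 2 := pow_le_pow_left₀ ENNReal.toReal_nonneg h2 2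
      _ = K ^ 2 * (1 + ‖x₀‖) ^ (m + m) := by rw [pow_add]; ring
  -- near part: Hölder `(12/5, 12/7)`
  have hnear : |nearPotential 1 2 v x| ≤ NΓ * KG * (1 + ‖x₀‖) ^ (m + m) := by
    set Gv := pressureSource v with hGv
    have hGc : Continuous Gv := (contDiff_pressureSource (n := 0) (hvs.of_le (by norm_cast))).continuous
    have hGs : HasCompactSupport Gv := by
      refine HasCompactSupport.intro (isCompact_closedBall x₀ (8 * ρ)) fun y hy => ?_
      obtain ⟨KG', -, hG'⟩ := exists_abs_pressureSource_locF_le hρ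
      exact (hG' hU x₀ y).2 hy
    rw [nearPotential]
    have hpq : (12 / 5 : ℝ).HolderConjugate (12 / 7) := ⟨by norm_num, by norm_num, by norm_num⟩
    have hF : MemLp (fun z => |newtonNear (1 : ℝ) 2 z|) (ENNReal.ofReal (12 / 5)) volume := memLp_newtonNear.abs
    have hGxs : Continuous fun z => Gv (x - z) := hGc.comp (continuous_const.sub continuous_id)
    have hGxc : HasCompactSupport fun z => Gv (x - z) := hGs.comp_homeomorph (Homeomorph.subLeft x)
    have hGm : MemLp (fun z => |Gv (x - z)|) (ENNReal.ofReal (12 / 7)) volume :=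
      (hGxs.memLp_of_hasCompactSupport hGxc).abs
    have hH := integral_mul_le_Lp_mul_Lq_of_nonneg hpq (Eventually.of_forall fun z => abs_nonneg _)
      (Eventually.of_forall fun z => abs_nonneg _) hF hGm (μ := volume)
    -- identify the factors
    have e1 : (∫ z, |newtonNear (1 : ℝ) 2 z| ^ (12 / 5 : ℝ)) ^ (1 / (12 / 5 : ℝ)) = NΓ := by
      rw [hNΓ, memLp_newtonNear.eLpNorm_eq_integral_rpow_norm (by norm_num) ENNReal.ofReal_ne_top,
        ENNReal.toReal_ofReal (by positivity), ENNReal.toReal_ofReal (by norm_num)]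
      simp only [Real.norm_eq_abs, one_div]
    have e2 : (∫ z, |Gv (x - z)| ^ (12 / 7 : ℝ)) ^ (1 / (12 / 7 : ℝ)) =
        (eLpNorm Gv (ENNReal.ofReal (12 / 7)) volume).toReal := by
      have hGmem : MemLp Gv (ENNReal.ofReal (12 / 7)) volume := hGc.memLp_of_hasCompactSupport hGs
      rw [hGmem.eLpNorm_eq_integral_rpow_norm (by norm_num) ENNReal.ofReal_ne_top,
        ENNReal.toReal_ofReal (by positivity), ENNReal.toReal_ofReal (by norm_num)]
      simp only [Real.norm_eq_abs, one_div]
      congr 1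
      exact integral_sub_left_eq_self (fun w => |Gv w| ^ (12 / 7 : ℝ)) volume x
    have e3 : (eLpNorm Gv (ENNReal.ofReal (12 / 7)) volume).toReal ≤ KG * (1 + ‖x₀‖) ^ (m + m) :=
      ENNReal.toReal_le_of_le_ofReal (by positivity) (hG x₀)
    calc |∫ z, newtonNear 1 2 z * Gv (x - z)| ≤ ∫ z, |newtonNear 1 2 z| * |Gv (x - z)| := by
          refine (abs_integral_le_integral_abs).trans (le_of_eq (integral_congr_ae (Eventually.of_forall fun z => ?_)))
          simp only [abs_mul]
      _ ≤ NΓ * (eLpNorm Gv (ENNReal.ofReal (12 / 7)) volume).toReal := by rw [← e1, ← e2]; exact hH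
      _ ≤ NΓ * (KG * (1 + ‖x₀‖) ^ (m + m)) := mul_le_mul_of_nonneg_left e3 hNΓ0
      _ = NΓ * KG * (1 + ‖x₀‖) ^ (m + m) := by ring
  calc |(-nearPotential 1 2 v x - farPotential 1 2 v x)|
      ≤ |nearPotential 1 2 v x| + |farPotential 1 2 v x| := by
        rw [← abs_neg (nearPotential 1 2 v x)]; exact abs_sub _ _
    _ ≤ NΓ * KG * (1 + ‖x₀‖) ^ (m + m) + M₀ * K ^ 2 * (1 + ‖x₀‖) ^ (m + m) := add_le_add hnear hfar
    _ = (NΓ * KG + M₀ * K ^ 2) * (1 + ‖x₀‖) ^ (m + m) := by ring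

end SupBound

end Literature.Analysis.FluidPDE

end
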